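import Literature.Analysis.OperatorTheory.TwistedKernelFluxEnergies
import HarnessLib

/-!
# Populated flux sectors: a flux-carrying function that survives one transfer step populates its sector

Topic `Literature/Analysis/OperatorTheory`; sequel of `TwistedKernelFluxSectors.lean` / `TwistedKernelFluxEnergies.lean`
(the electric-flux sectors `z_ψ(M+2) = Σᵢ λᵢ^M qᵢ(ψ)`, `qᵢ(ψ) = ‖P_ψ κbᵢ‖² ≥ 0`, of a bounded symmetric kernel `K` with an
eigenbasis `A bᵢ = λᵢ bᵢ` under a finite abelian group `Γ` of measure-preserving twists `T k`; a sector is NON-DEGENERATE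
(«populated») when `∃ i, qᵢ(ψ) ≠ 0 ∧ λᵢ > 0`, equivalently `z_ψ(3) > 0`, and then 't Hooft's zero-temperature limit of the
flux free energy exists in it).  Theorem-only; no definitions, no named facts.

AS PRINTED.  G. 't Hooft, Nucl. Phys. B 153 (1979) 141, §4 (4.6)–(4.10) (reprint C. Rebbi (ed.), *Lattice Gauge Theories
and Monte Carlo Simulations* (1983) p. 552): the loop operator `A(C)` of a closed curve winding the box in the 3-direction
satisfies `A(C) Ω[k] = Ω[k] e^{−2πik₃/N} A(C)` ((4.8)–(4.9)), hence maps a state of flux `e` to a state with «`e₃` replaced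
by `e₃ + 1`» ((4.10)): «A(C) can be considered to be the creation operator of an electric flux line.  The conserved
integers `eᵢ` therefore indicate total amount of electric flux in the three directions.»  What this file isolates is the
abstract half of that statement for a transfer operator given by a kernel: a sector `ψ` is populated as soon as ONE
square-integrable function `u` of flux `ψ` — `u ∘ T_k = ψ(k) · u` for all `k` ('t Hooft's covariance (4.8)) — survives one
transfer step, `κu = ∫ K(·, y) u(y) dμ(y) ≠ 0` (not a.e. zero).  (The Wilson-theory half — the traced Polyakov loop of a
time slice is such a `u` — is `Literature/MathematicalPhysics/QuantumFieldTheory/WilsonFinTorusFluxSectorsPopulated.lean`.)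

PROVED (hypotheses as in the companion files):

* `integral_conj_mul_comp_twist` — for `u` of flux `ψ` and any bounded measurable real `c`:
  `∫ conj(u x) c(T_k x) dμ = ψ(k) ∫ conj(u x) c(x) dμ` (measure preservation and the group law);
* `integral_conj_mul_section_eq_zero` — if the flux-`ψ` projection `Σ_k conj ψ(k) cᵢ(T_k x)` of the section `cᵢ = κbᵢ`
  vanishes a.e., then `u ⊥ cᵢ`: `∫ conj(u) cᵢ dμ = 0`;
* `fluxProjection_section_ae_eq_zero` — `qᵢ(ψ) = 0` forces that projection to vanish a.e. (`qᵢ(ψ) = |Γ|⁻² ∫ ‖·‖²`);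
* ★ `exists_fluxCoeff_ne_zero_of_covariant` — **a flux-`ψ` function with `κu ≢ 0` populates the sector `ψ`**:
  `∃ i, qᵢ(ψ) ≠ 0 ∧ λᵢ > 0` (contrapositive: if every `qᵢ(ψ)` with `λᵢ > 0` vanished, `u` would be orthogonal to every
  `λᵢ bᵢ` with `λᵢ ≠ 0`, so `A(Re u) = A(Im u) = 0`, i.e. `κu = 0` a.e.);
* `re_fluxSector_pos_of_covariant` — consequently `z_ψ(M+2) > 0` for every period (`re_fluxSector_pos`).

HONEST FRAMING: finite-volume transfer-operator bookkeeping (one positive kernel, one finite symmetry group); nothing here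
bears on the size dependence of flux energies, duality, or a mass gap.

References: 't Hooft 1979 §4 (4.6)–(4.10), §5 (5.1)–(5.3); J.-P. Serre, *Linear Representations of Finite Groups* (1977)
§2.6 Thm 8 (ii) (isotypic projections); M. Reed, B. Simon, *Methods of Modern Mathematical Physics* I (1980) Thm VI.22–23
(Hilbert–Schmidt expansion).
-/

noncomputable section

namespace Literature.Analysis.OperatorTheory

open MeasureTheory Filter Set Function Finset
open scoped RealInnerProductSpace ENNReal ComplexConjugate BigOperators

section Population

variable {X : Type*} [MeasurableSpace X] {μ : Measure X} [IsFiniteMeasure μ]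
  {K : X → X → ℝ} {C : ℝ} {A : Lp ℝ 2 μ →L[ℝ] Lp ℝ 2 μ} {ι : Type*}
  {b : HilbertBasis ι ℝ (Lp ℝ 2 μ)} {lam : ι → ℝ}
  {Γ : Type*} [AddCommGroup Γ] [Fintype Γ] {T : Γ → X → X}

omit [IsFiniteMeasure μ] in
/-- **Covariance under one twist, integrated** ('t Hooft (4.8)–(4.9) in matrix-element form): for a bounded measurable
`u` of flux `ψ` — `u (T_k x) = ψ(k) u(x)` — and a bounded measurable real `c`,
`∫ conj(u x) · c(T_k x) dμ = ψ(k) · ∫ conj(u x) · c(x) dμ` (substitute `x = T_{−k} y`; `T_k` preserves `μ`).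
[cite: tHooft1979Flux, §4 (4.8)–(4.9)] -/
theorem integral_conj_mul_comp_twist (hT : ∀ k, MeasurePreserving (T k) μ μ) (hT0 : T 0 = id)
    (hTadd : ∀ k k' x, T (k + k') x = T k (T k' x)) (ψ : AddChar Γ ℂ) {u : X → ℂ} (hu : Measurable u)
    (hcov : ∀ k x, u (T k x) = ψ k * u x) {c : X → ℝ} (hc : Measurable c) (k : Γ) :
    ∫ x, conj (u x) * (c (T k x) : ℂ) ∂μ = ψ k * ∫ x, conj (u x) * (c x : ℂ) ∂μ := by
  set F : X → ℂ := fun y => conj (u (T (-k) y)) * (c y : ℂ) with hF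
  have hback : ∀ x, T (-k) (T k x) = x := fun x => by
    rw [← hTadd, neg_add_cancel, hT0, id_eq]
  have h1 : (fun x => conj (u x) * (c (T k x) : ℂ)) = fun x => F (T k x) := by
    funext x
    simp only [hF, hback]
  have hFm : AEStronglyMeasurable F (Measure.map (T k) μ) := by
    rw [(hT k).map_eq]
    exact ((Complex.continuous_conj.measurable.comp (hu.comp (hT (-k)).measurable)).mul
      (Complex.measurable_ofReal.comp hc)).aestronglyMeasurable
  have h2 := integral_map (μ := μ) (hT k).measurable.aemeasurable hFm
  rw [(hT k).map_eq] at h2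
  rw [h1, ← h2]
  have h3 : ∀ y, F y = ψ k * (conj (u y) * (c y : ℂ)) := fun y => by
    simp only [hF]
    rw [hcov (-k) y, map_mul, AddChar.map_neg_eq_conj, Complex.conj_conj, mul_assoc]
  simp_rw [h3]
  exact integral_const_mul _ _

omit [IsFiniteMeasure μ] in
/-- **Orthogonality to a section whose flux-`ψ` projection vanishes.**  If `Σ_k conj ψ(k) c(T_k x) = 0` for a.e. `x`,
then every bounded measurable `u` of flux `ψ` is orthogonal to `c`: `∫ conj(u) c dμ = 0` — integrate `conj(u)` against
the vanishing projection and use `integral_conj_mul_comp_twist`: `0 = Σ_k conj ψ(k) ψ(k) ∫ conj(u) c = |Γ| ∫ conj(u) c`.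
[cite: tHooft1979Flux, §4 (4.8)–(4.10)] [cite: Serre1977, §2.6 Thm 8 (ii)] -/
theorem integral_conj_mul_section_eq_zero (hT : ∀ k, MeasurePreserving (T k) μ μ) (hT0 : T 0 = id)
    (hTadd : ∀ k k' x, T (k + k') x = T k (T k' x)) (ψ : AddChar Γ ℂ) {u : X → ℂ} (hu : Measurable u)
    {B : ℝ} (huB : ∀ x, ‖u x‖ ≤ B) (hcov : ∀ k x, u (T k x) = ψ k * u x) {c : X → ℝ} (hc : Measurable c)
    {B' : ℝ} (hcB : ∀ x, |c x| ≤ B') [IsFiniteMeasure μ]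
    (hS : (fun x => ∑ k, conj (ψ k) * (c (T k x) : ℂ)) =ᵐ[μ] 0) :
    ∫ x, conj (u x) * (c x : ℂ) ∂μ = 0 := by
  have hcard : (Fintype.card Γ : ℂ) ≠ 0 := Nat.cast_ne_zero.2 Fintype.card_ne_zero
  -- integrability of the pieces
  have hint : ∀ k, Integrable (fun x => conj (u x) * (c (T k x) : ℂ)) μ := fun k => by
    refine Integrable.of_bound (((Complex.continuous_conj.measurable.comp hu).mul
      (Complex.measurable_ofReal.comp (hc.comp (hT k).measurable))).aestronglyMeasurable) (B * B')
      (Eventually.of_forall fun x => ?_)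
    rw [norm_mul, Complex.norm_conj, Complex.norm_real, Real.norm_eq_abs]
    exact mul_le_mul (huB x) (hcB _) (abs_nonneg _) ((norm_nonneg _).trans (huB x))
  -- `0 = ∫ conj(u) · S`
  have h0 : ∫ x, conj (u x) * ∑ k, conj (ψ k) * (c (T k x) : ℂ) ∂μ = 0 := by
    refine integral_eq_zero_of_ae ?_
    filter_upwards [hS] with x hx
    rw [hx, Pi.zero_apply, mul_zero]
  -- expand the finite sum
  have h1 : ∫ x, conj (u x) * ∑ k, conj (ψ k) * (c (T k x) : ℂ) ∂μ =
      ∑ k, conj (ψ k) * (ψ k * ∫ x, conj (u x) * (c x : ℂ) ∂μ) := by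
    have hterm : ∀ x, conj (u x) * ∑ k, conj (ψ k) * (c (T k x) : ℂ) =
        ∑ k, conj (ψ k) * (conj (u x) * (c (T k x) : ℂ)) := fun x => by
      rw [Finset.mul_sum]
      exact Finset.sum_congr rfl fun k _ => by ring
    simp_rw [hterm]
    rw [integral_finsetSum _ fun k _ => (hint k).const_mul _]
    refine Finset.sum_congr rfl fun k _ => ?_
    rw [integral_const_mul, integral_conj_mul_comp_twist hT hT0 hTadd ψ hu hcov hc k]
  have h2 : ∑ k, conj (ψ k) * (ψ k * ∫ x, conj (u x) * (c x : ℂ) ∂μ) =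
      (Fintype.card Γ : ℂ) * ∫ x, conj (u x) * (c x : ℂ) ∂μ := by
    have hone : ∀ k, conj (ψ k) * ψ k = 1 := fun k => by
      rw [← AddChar.map_neg_eq_conj, ← AddChar.map_add_eq_mul, neg_add_cancel, AddChar.map_zero_eq_one]
    simp_rw [← mul_assoc, hone, one_mul]
    rw [Finset.sum_const, Finset.card_univ, nsmul_eq_mul]
  rw [h1, h2] at h0
  exact (mul_eq_zero.1 h0).resolve_left hcard

/-- **A vanishing flux coefficient kills the flux-`ψ` projection of the section**: if `qᵢ(ψ) = 0` then
`Σ_k conj ψ(k) (κbᵢ)(T_k x) = 0` for a.e. `x` (`qᵢ(ψ) = |Γ|⁻² ∫ ‖Σ_k conj ψ(k) (κbᵢ)(T_k x)‖² dμ`,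
`fluxCoeff_eq_integral_norm_sq`). [cite: tHooft1979Flux, §5 (5.1)–(5.2)] [cite: Serre1977, §2.6 Thm 8 (ii)] -/
theorem fluxProjection_section_ae_eq_zero (hK : StronglyMeasurable (uncurry K)) (hC : ∀ x y, ‖K x y‖ ≤ C)
    (hT : ∀ k, MeasurePreserving (T k) μ μ) (hT0 : T 0 = id) (hTadd : ∀ k k' x, T (k + k') x = T k (T k' x))
    (i : ι) (ψ : AddChar Γ ℂ)
    (hq : ((Fintype.card Γ : ℂ)⁻¹ * ∑ k, conj (ψ k) *
        ((∫ x, (∫ z, K (T k x) z * b i z ∂μ) * (∫ z, K x z * b i z ∂μ) ∂μ : ℝ) : ℂ)).re = 0) :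
    (fun x => ∑ k, conj (ψ k) * ((∫ z, K (T k x) z * b i z ∂μ : ℝ) : ℂ)) =ᵐ[μ] 0 := by
  set c : X → ℝ := fun x => ∫ z, K x z * b i z ∂μ with hc
  have hcm : Measurable c := measurable_integral_kernel_mul_basis hK b i
  have hq' := congrArg Complex.re (fluxCoeff_eq_integral_norm_sq (b := b) hK hC hT hT0 hTadd i ψ)
  rw [hq, Complex.ofReal_re] at hq'
  have hcard : (0 : ℝ) < (Fintype.card Γ : ℝ)⁻¹ ^ 2 :=
    pow_pos (inv_pos.2 (Nat.cast_pos.2 Fintype.card_pos)) 2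
  have hint0 : ∫ x, ‖∑ k, conj (ψ k) * (c (T k x) : ℂ)‖ ^ 2 ∂μ = 0 :=
    (mul_eq_zero.1 hq'.symm).resolve_left hcard.ne'
  -- the integrand is bounded and measurable
  have hC' : ∀ x y, ‖K x y‖ ≤ |C| := fun x y => (hC x y).trans (le_abs_self C)
  set B : ℝ := |C| * Real.sqrt (μ.real univ) * ‖(b i : Lp ℝ 2 μ)‖ with hB
  have hcb : ∀ y, |c y| ≤ B := fun y => abs_integral_kernel_mul_le hC' (abs_nonneg C) (b i) y
  have hSm : Measurable fun x => ∑ k, conj (ψ k) * (c (T k x) : ℂ) :=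
    Finset.measurable_sum _ fun k _ =>
      (Complex.measurable_ofReal.comp (hcm.comp (hT k).measurable)).const_mul _
  have hSb : ∀ x, ‖∑ k, conj (ψ k) * (c (T k x) : ℂ)‖ ≤ Fintype.card Γ * B := fun x => by
    calc ‖∑ k, conj (ψ k) * (c (T k x) : ℂ)‖ ≤ ∑ k, ‖conj (ψ k) * (c (T k x) : ℂ)‖ := norm_sum_le _ _
      _ ≤ ∑ _k : Γ, B := Finset.sum_le_sum fun k _ => by
          rw [norm_mul, Complex.norm_conj, AddChar.norm_apply, one_mul, Complex.norm_real, Real.norm_eq_abs]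
          exact hcb _
      _ = Fintype.card Γ * B := by rw [Finset.sum_const, Finset.card_univ, nsmul_eq_mul]
  have hint : Integrable (fun x => ‖∑ k, conj (ψ k) * (c (T k x) : ℂ)‖ ^ 2) μ := by
    refine Integrable.of_bound ((hSm.norm.pow_const 2).aestronglyMeasurable) ((Fintype.card Γ * B) ^ 2)
      (Eventually.of_forall fun x => ?_)
    rw [Real.norm_eq_abs, abs_pow, abs_norm]
    exact pow_le_pow_left₀ (norm_nonneg _) (hSb x) 2
  have hae : (fun x => ‖∑ k, conj (ψ k) * (c (T k x) : ℂ)‖ ^ 2) =ᵐ[μ] 0 :=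
    (integral_eq_zero_iff_of_nonneg (fun x => sq_nonneg _) hint).1 hint0
  filter_upwards [hae] with x hx
  have h : ‖∑ k, conj (ψ k) * (c (T k x) : ℂ)‖ = 0 := pow_eq_zero_iff two_ne_zero |>.1 hx
  exact norm_eq_zero.1 h

/-- ★ **A flux-carrying function that survives one transfer step populates its sector** ('t Hooft (4.6)–(4.10): the
loop operator `A(C)` «is the creation operator of an electric flux line»; here in transfer-operator form).  Let `u` be
bounded measurable of flux `ψ` (`u ∘ T_k = ψ(k) · u`) with `κu = ∫ K(·, y) u(y) dμ(y)` NOT a.e. zero.  Then the sector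
`ψ` is non-degenerate: `∃ i, qᵢ(ψ) ≠ 0 ∧ λᵢ > 0`.  Proof (contrapositive): if `qᵢ(ψ) = 0` whenever `λᵢ > 0`, the
flux-`ψ` projections of the sections `κbᵢ` vanish a.e., so `u ⊥ κbᵢ = λᵢ bᵢ`, i.e. `λᵢ ⟪bᵢ, Re u⟫ = λᵢ ⟪bᵢ, Im u⟫ = 0`
for ALL `i`; expanding in the Hilbert basis, `A(Re u) = A(Im u) = 0`, whence `κu = 0` a.e.
[cite: tHooft1979Flux, §4 (4.6)–(4.10)] [cite: ReedSimonI1980, Thm. VI.22–23] -/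
theorem exists_fluxCoeff_ne_zero_of_covariant (hK : StronglyMeasurable (uncurry K)) (hC : ∀ x y, ‖K x y‖ ≤ C)
    (hA : ∀ φ : Lp ℝ 2 μ, (A φ : X → ℝ) =ᵐ[μ] fun x => ∫ y, K x y * φ y ∂μ)
    (hb : ∀ i, A (b i) = lam i • b i) (hlam : ∀ i, 0 ≤ lam i) (hT : ∀ k, MeasurePreserving (T k) μ μ)
    (hT0 : T 0 = id) (hTadd : ∀ k k' x, T (k + k') x = T k (T k' x)) (ψ : AddChar Γ ℂ) {u : X → ℂ}
    (hu : Measurable u) {B : ℝ} (huB : ∀ x, ‖u x‖ ≤ B) (hcov : ∀ k x, u (T k x) = ψ k * u x)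
    (hκu : ¬ ((fun x => ∫ y, (K x y : ℂ) * u y ∂μ) =ᵐ[μ] 0)) :
    ∃ i, ((Fintype.card Γ : ℂ)⁻¹ * ∑ k, conj (ψ k) *
        ((∫ x, (∫ z, K (T k x) z * b i z ∂μ) * (∫ z, K x z * b i z ∂μ) ∂μ : ℝ) : ℂ)).re ≠ 0 ∧ 0 < lam i := by
  by_contra hcon
  push Not at hcon
  apply hκu
  -- notation
  set c : ι → X → ℝ := fun i x => ∫ z, K x z * b i z ∂μ with hc
  have hcm : ∀ i, Measurable (c i) := fun i => measurable_integral_kernel_mul_basis hK b i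
  have hC' : ∀ x y, ‖K x y‖ ≤ |C| := fun x y => (hC x y).trans (le_abs_self C)
  have hcb : ∀ i y, |c i y| ≤ |C| * Real.sqrt (μ.real univ) * ‖(b i : Lp ℝ 2 μ)‖ := fun i y =>
    abs_integral_kernel_mul_le hC' (abs_nonneg C) (b i) y
  -- the real and imaginary parts of `u` as elements of `L²`
  have huRm : Measurable fun x => (u x).re := Complex.measurable_re.comp hu
  have huIm : Measurable fun x => (u x).im := Complex.measurable_im.comp hu
  have huRB : ∀ x, ‖(u x).re‖ ≤ B := fun x => (Complex.abs_re_le_norm _).trans (huB x)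
  have huIB : ∀ x, ‖(u x).im‖ ≤ B := fun x => (Complex.abs_im_le_norm _).trans (huB x)
  have hmR : MemLp (fun x => (u x).re) 2 μ := MemLp.of_bound huRm.aestronglyMeasurable B (Eventually.of_forall huRB)
  have hmI : MemLp (fun x => (u x).im) 2 μ := MemLp.of_bound huIm.aestronglyMeasurable B (Eventually.of_forall huIB)
  set UR : Lp ℝ 2 μ := hmR.toLp _ with hUR
  set UI : Lp ℝ 2 μ := hmI.toLp _ with hUI
  -- Step 1: `u ⊥ cᵢ` whenever `λᵢ > 0`, hence `λᵢ ∫ v cᵢ = 0` for `v = Re u, Im u` and all `i`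
  have hJ : ∀ i, 0 < lam i → ∫ x, conj (u x) * (c i x : ℂ) ∂μ = 0 := fun i hi => by
    have hq : ((Fintype.card Γ : ℂ)⁻¹ * ∑ k, conj (ψ k) *
        ((∫ x, (∫ z, K (T k x) z * b i z ∂μ) * (∫ z, K x z * b i z ∂μ) ∂μ : ℝ) : ℂ)).re = 0 := by
      by_contra hq
      exact absurd (hcon i hq) (not_le.2 hi)
    exact integral_conj_mul_section_eq_zero hT hT0 hTadd ψ hu huB hcov (hcm i) (hcb i)
      (fluxProjection_section_ae_eq_zero hK hC hT hT0 hTadd i ψ hq)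
  have hintR : ∀ i, Integrable (fun x => conj (u x) * (c i x : ℂ)) μ := fun i => by
    refine Integrable.of_bound (((Complex.continuous_conj.measurable.comp hu).mul
      (Complex.measurable_ofReal.comp (hcm i))).aestronglyMeasurable)
      (B * (|C| * Real.sqrt (μ.real univ) * ‖(b i : Lp ℝ 2 μ)‖)) (Eventually.of_forall fun x => ?_)
    rw [norm_mul, Complex.norm_conj, Complex.norm_real, Real.norm_eq_abs]
    exact mul_le_mul (huB x) (hcb i x) (abs_nonneg _) ((norm_nonneg _).trans (huB x))
  -- real parts: `∫ Re(u) cᵢ = Re ∫ conj(u) cᵢ`, imaginary parts: `∫ Im(u) cᵢ = −Im ∫ conj(u) cᵢ`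
  have hreJ : ∀ i, ∫ x, (u x).re * c i x ∂μ = (∫ x, conj (u x) * (c i x : ℂ) ∂μ).re := fun i => by
    have h := integral_re (hintR i)
    simp only [RCLike.re_to_complex] at h
    rw [← h]
    refine integral_congr_ae (Eventually.of_forall fun x => ?_)
    simp only [Complex.mul_re, Complex.conj_re, Complex.conj_im, Complex.ofReal_re, Complex.ofReal_im, mul_zero,
      sub_zero]
  have himJ : ∀ i, ∫ x, (u x).im * c i x ∂μ = -(∫ x, conj (u x) * (c i x : ℂ) ∂μ).im := fun i => by
    have h := integral_im (hintR i)
    simp only [RCLike.im_to_complex] at h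
    rw [← h, ← integral_neg]
    refine integral_congr_ae (Eventually.of_forall fun x => ?_)
    simp only [Complex.mul_im, Complex.conj_re, Complex.conj_im, Complex.ofReal_re, Complex.ofReal_im, mul_zero,
      zero_add, neg_mul, neg_neg]
  -- `cᵢ = λᵢ bᵢ` a.e.
  have hcae : ∀ i, c i =ᵐ[μ] fun x => lam i * b i x := fun i => by
    have h1 := hA (b i)
    rw [hb i] at h1
    filter_upwards [h1, Lp.coeFn_smul (lam i) (b i : Lp ℝ 2 μ)] with x hx hs
    show (∫ z, K x z * b i z ∂μ) = lam i * b i x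
    rw [← hx, hs, Pi.smul_apply, smul_eq_mul]
  -- inner products with the basis
  have hinner : ∀ (i) {v : X → ℝ} (hv : MemLp v 2 μ),
      ⟪(b i : Lp ℝ 2 μ), hv.toLp v⟫ = ∫ x, v x * b i x ∂μ := fun i v hv => by
    rw [L2.inner_def]
    refine integral_congr_ae ?_
    filter_upwards [hv.coeFn_toLp] with x hx
    rw [hx, real_inner_comm, RCLike.inner_apply, conj_trivial, mul_comm]
  have hkill : ∀ (i) {v : X → ℝ} (hv : MemLp v 2 μ) (hvm : Measurable v) (hvB : ∀ x, ‖v x‖ ≤ B)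
      (hvJ : 0 < lam i → ∫ x, v x * c i x ∂μ = 0), lam i * ⟪(b i : Lp ℝ 2 μ), hv.toLp v⟫ = 0 := by
    intro i v hv hvm hvB hvJ
    rcases (hlam i).eq_or_lt with h0 | hpos
    · rw [← h0, zero_mul]
    · have h1 : ∫ x, v x * c i x ∂μ = lam i * ∫ x, v x * b i x ∂μ := by
        rw [← integral_const_mul]
        refine integral_congr_ae ?_
        filter_upwards [hcae i] with x hx
        rw [hx]; ring
      rw [hinner i hv, ← h1]
      exact hvJ hpos
  -- Step 2: `A v = 0` for `v = Re u, Im u`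
  have hAzero : ∀ {v : X → ℝ} (hv : MemLp v 2 μ), (∀ i, lam i * ⟪(b i : Lp ℝ 2 μ), hv.toLp v⟫ = 0) →
      A (hv.toLp v) = 0 := by
    intro v hv hk
    have h1 := (b.hasSum_repr (hv.toLp v)).mapL A
    have h2 : (fun i => A (b.repr (hv.toLp v) i • (b i : Lp ℝ 2 μ))) = fun _ => 0 := by
      funext i
      rw [ContinuousLinearMap.map_smul, hb i, smul_smul, HilbertBasis.repr_apply_apply, mul_comm, hk i, zero_smul]
    rw [h2] at h1
    exact h1.unique hasSum_zero
  have hAR : A UR = 0 := hAzero hmR fun i => hkill i hmR huRm huRB fun hi => by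
    rw [hreJ i, hJ i hi, Complex.zero_re]
  have hAI : A UI = 0 := hAzero hmI fun i => hkill i hmI huIm huIB fun hi => by
    rw [himJ i, hJ i hi, Complex.zero_im, neg_zero]
  -- Step 3: `κ(Re u) = κ(Im u) = 0` a.e.
  have hκ : ∀ {v : X → ℝ} (hv : MemLp v 2 μ), A (hv.toLp v) = 0 →
      (fun x => ∫ y, K x y * v y ∂μ) =ᵐ[μ] 0 := by
    intro v hv h0
    have h1 := hA (hv.toLp v)
    rw [h0] at h1
    have h2 : ∀ x, ∫ y, K x y * (hv.toLp v) y ∂μ = ∫ y, K x y * v y ∂μ := fun x =>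
      integral_congr_ae (by filter_upwards [hv.coeFn_toLp] with y hy; rw [hy])
    filter_upwards [h1, Lp.coeFn_zero ℝ 2 μ] with x hx hz
    rw [Pi.zero_apply, ← h2 x, ← hx, hz, Pi.zero_apply]
  -- Step 4: recombine real and imaginary parts
  have hintK : ∀ (x) {v : X → ℝ} (hvm : Measurable v) (hvB : ∀ y, ‖v y‖ ≤ B),
      Integrable (fun y => K x y * v y) μ := fun x v hvm hvB => by
    refine Integrable.of_bound (((hK.measurable.of_uncurry_left (x := x)).mul hvm).aestronglyMeasurable)
      (|C| * B) (Eventually.of_forall fun y => ?_)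
    rw [norm_mul]
    exact mul_le_mul (hC' x y) (hvB y) (norm_nonneg _) (abs_nonneg _)
  have hsplit : ∀ x, ∫ y, (K x y : ℂ) * u y ∂μ =
      ((∫ y, K x y * (u y).re ∂μ : ℝ) : ℂ) + ((∫ y, K x y * (u y).im ∂μ : ℝ) : ℂ) * Complex.I := fun x => by
    have h1 : ∀ y, (K x y : ℂ) * u y =
        ((K x y * (u y).re : ℝ) : ℂ) + ((K x y * (u y).im : ℝ) : ℂ) * Complex.I := fun y => by
      conv_lhs => rw [← Complex.re_add_im (u y)]
      push_cast
      ring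
    simp_rw [h1]
    rw [integral_add ((hintK x huRm huRB).ofReal) (((hintK x huIm huIB).ofReal).mul_const _),
      integral_mul_const, integral_complex_ofReal, integral_complex_ofReal]
  filter_upwards [hκ hmR hAR, hκ hmI hAI] with x hxR hxI
  rw [hsplit x, hxR, hxI, Pi.zero_apply, Pi.zero_apply, Complex.ofReal_zero, zero_mul, add_zero]

/-- **A flux-carrying function that survives one transfer step makes every `z_ψ(M+2)` strictly positive**
(`exists_fluxCoeff_ne_zero_of_covariant` with `re_fluxSector_pos`). [cite: tHooft1979Flux, §4 (4.6)–(4.10) and §5 (5.3)] -/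
theorem re_fluxSector_pos_of_covariant [Countable ι] (hK : StronglyMeasurable (uncurry K))
    (hC : ∀ x y, ‖K x y‖ ≤ C) (hsymm : ∀ x y, K x y = K y x)
    (hA : ∀ φ : Lp ℝ 2 μ, (A φ : X → ℝ) =ᵐ[μ] fun x => ∫ y, K x y * φ y ∂μ)
    (hb : ∀ i, A (b i) = lam i • b i) (hlam : ∀ i, 0 ≤ lam i) (hT : ∀ k, MeasurePreserving (T k) μ μ)
    (hT0 : T 0 = id) (hTadd : ∀ k k' x, T (k + k') x = T k (T k' x)) {z : Γ → ℕ → ℝ}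
    (hz : ∀ k M, z k (M + 2) =
      ∫ x, ((fun f : X → ℝ => fun w => ∫ y, K w y * f y ∂μ)^[M + 1] (fun y => K y x)) (T k x) ∂μ)
    (ψ : AddChar Γ ℂ) {u : X → ℂ} (hu : Measurable u) {B : ℝ} (huB : ∀ x, ‖u x‖ ≤ B)
    (hcov : ∀ k x, u (T k x) = ψ k * u x) (hκu : ¬ ((fun x => ∫ y, (K x y : ℂ) * u y ∂μ) =ᵐ[μ] 0)) (M : ℕ) :
    0 < ((Fintype.card Γ : ℂ)⁻¹ * ∑ k, conj (ψ k) * (z k (M + 2) : ℂ)).re :=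
  re_fluxSector_pos hK hC hsymm hA hb hlam hT hT0 hTadd hz
    (exists_fluxCoeff_ne_zero_of_covariant hK hC hA hb hlam hT hT0 hTadd ψ hu huB hcov hκu) M

end Population

end Literature.Analysis.OperatorTheory

end
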